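import Summits.BirchSwinnertonDyer.BirchSwinnertonDyer.Theorems.BiquadraticEisensteinDescentEisensteinHeartFlatCMInertBadKPrimeSqrtEndomorphismTwist
import HarnessLib

set_option linter.dupNamespace false -- `Summit.BirchSwinnertonDyer.BirchSwinnertonDyer.Theorems.…` (summit = sub)
set_option autoImplicit false

/-!
# Crux `EisensteinHeartFlatCMInertBadKPrime` (stmt-BirchSwinnertonDyer-21341), line `hsieh-lambda`, stub `stub_sqrtEndomorphism` —
# the CM endomorphism `[√-3]` (`j = 54000`, the order `ℤ[√-3]` of discriminant `-12`) in Galois sign form on every elliptic curve with that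
# `j`-invariant over a field `K ∌ √-3` of characteristic `0`

Route `BiquadraticEisensteinDescent` (cell `pub/bsd-wall`, width-prover seat `bsd-wall-cm-bed-w4` g7). Second companion of
`…SqrtEndomorphismTwist` (w1 g5; the order `-27`, `j = -12288000`, is `…CMLeafTwentySeven`): `j = 54000 ≠ 0, 1728`, so its
certificate-to-every-curve theorem `exists_endomorphism_of_cert` applies VERBATIM once a checked CM twist certificate of ODD degree is
supplied (the two remaining `j = 8000, 287496` have CM endomorphisms `[√-2]`, `[2i]` of EVEN degree — separate file):

* `exists_sqrt_endomorphism_of_j_eq_54000` — the `3`-isogeny `E → E/E[√-3] = E^{(-3)}` of the short model `E = [0, 0, 0, -15, 22]`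
  (`36a2`, `j = 54000 = 2⁴3³5³`, `End = ℤ[√-3]`) onto `[0, 0, 0, -135, -594]`, kernel `{O, (3, ±2)} = E[√-3]`, Vélu: `U = X³ - 6X² + 33X - 56`,
  `h = X - 3`, `S = U'h - 2Uh' = X³ - 9X² + 3X + 13`, `T = 0` — written INLINE as an `IsogenyCert` literal (no new definition) and
  closed by `decide` (`check`, `checkCoprime` with the Bézout certificate `5629·Ū + (4378X² + 6880X + 5002)·h̄ ≡ 1 (mod 10007)`);
  whence on every `V/K` with `j(V) = 54000`, for `r² = -3`, `σ₀ r = -r`: `ψ` with the two sign rules and `ψ ∘ ψ = [-3]`.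

THEOREMS ONLY (no definition, no named fact, no instance, no `sorry`); nothing about V2/V4 or any case of BSD is asserted; BSD is not
proved by any of this. Supports stmt-BirchSwinnertonDyer-21341 as a helper. The data were computed by Vélu's formulae from the
rational `3`-torsion point `(3, 2)` (session folder `kit/polycert.py`); only the kernel's `decide` is relied on.

References: [SilvermanAdvancedTopics1994] II §2 Prop. II.2.3.1, Thm. II.2.2(b), App. A §3 (the orders `-12`, `-27`); [SilvermanAEC2009]
III.4.8, Remark III.4.13.3, Cor. III.6.3, X.5 Prop. 5.4; [CremonaAlgorithms1997] §3.8 (Vélu), Table 1 (`36a`).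
-/

noncomputable section

open scoped Classical

open Polynomial WeierstrassCurve Field
  Literature.NumberTheory.EllipticCurves
  Literature.NumberTheory.EllipticCurves.PolyCert
  Summit.BirchSwinnertonDyer.BirchSwinnertonDyer.Theorems.BiquadraticEisensteinDescentEisensteinHeartFlatCMInertBadKPrimeSqrtEndomorphismTwist

namespace Summit.BirchSwinnertonDyer.BirchSwinnertonDyer.Theorems.BiquadraticEisensteinDescentEisensteinHeartFlatCMInertBadKPrimeSqrtEndomorphismOrderTwelve

variable {K : Type} [Field K] [CharZero K]

/-! ## `j = 54000` (order of discriminant `-12`): the `3`-isogeny of `36a2` onto its `-3`-twist -/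

/-- **`[√-3]` in sign form on EVERY elliptic curve with `j = 54000` over `K ∌ √-3`** (`char K = 0`): for `V/K` with `j(V) = 54000`,
`r ∈ K̄` with `r² = -3` and `σ₀ ∈ Γ_K` with `σ₀ r = -r`, an additive `ψ` on `V(K̄)` with `σ • ψ P = ψ (σ • P)` for `σ r = r`,
`σ • ψ P = -ψ (σ • P)` for `σ r = -r`, and `ψ (ψ P) = (-3) • P`. Certificate (inline): the Vélu `3`-isogeny of `E = [0,0,0,-15,22]`
with kernel `⟨(3, 2)⟩ = E[√-3]` onto `E^{(-3)} = [0,0,0,-135,-594]`, `U = X³ - 6X² + 33X - 56`, `h = X - 3`, `S = X³ - 9X² + 3X + 13`;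
transport to `V` by `…SqrtEndomorphismTwist.exists_endomorphism_of_cert`.
[cite: SilvermanAdvancedTopics1994, II §2, Prop. II.2.3.1 and App. A §3] [cite: SilvermanAEC2009, Remark III.4.13.3 and Cor. III.6.3] -/
theorem exists_sqrt_endomorphism_of_j_eq_54000 (V : WeierstrassCurve K) [V.IsElliptic] (hj : V.j = 54000)
    (r : AlgebraicClosure K) (hr : r ^ 2 = -3) (σ₀ : absoluteGaloisGroup K) (hσ₀ : σ₀ • r = -r) :
    ∃ ψ : V.geomPoints →+ V.geomPoints,
      (∀ σ : absoluteGaloisGroup K, σ • r = r → ∀ P, σ • ψ P = ψ (σ • P)) ∧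
      (∀ σ : absoluteGaloisGroup K, σ • r = -r → ∀ P, σ • ψ P = -ψ (σ • P)) ∧
      (∀ P, ψ (ψ P) = (-3 : ℤ) • P) := by
  have hr' : r ^ 2 = algebraMap K (AlgebraicClosure K) (((-3 : ℤ) : K)) := by
    rw [hr, Int.cast_neg, Int.cast_ofNat, map_neg, map_ofNat]
  have hr0 : r ≠ 0 := by rintro rfl; norm_num at hr
  exact exists_endomorphism_of_cert
    (c := ⟨0, 0, 0, -15, 22, 0, 0, 0, -135, -594, [-56, 33, -6, 1], [-3, 1], [13, 3, -9, 1], []⟩) (d := -3)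
    (by decide) ⟨rfl, rfl, rfl, rfl, rfl, rfl, by decide, by decide, rfl, by decide, by decide, by decide⟩
    ⟨10007, [5629], [5002, 6880, 4378], [10598, 6897, 10003, 1]⟩ (k' := 40) (by decide +kernel) (by norm_num)
    (n := 54000) (by decide) (by decide) (by norm_num) (by norm_num) r hr' hr0 σ₀ hσ₀ V (by rw [hj]; norm_num)

end Summit.BirchSwinnertonDyer.BirchSwinnertonDyer.Theorems.BiquadraticEisensteinDescentEisensteinHeartFlatCMInertBadKPrimeSqrtEndomorphismOrderTwelve

end
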